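import Summits.NavierStokesRegularity.NavierStokesRegularity.Theses.AngularGalerkinLadder
import Summits.NavierStokesRegularity.NavierStokesRegularity.Theorems.NoOverheating.Negative.TransversalAxisKinematics
import Summits.NavierStokesRegularity.NavierStokesRegularity.Theorems.NoOverheating.Negative.SineFormAlignmentExcluded
import HarnessLib

/-!
# Census strata (S15)/(S16): no K2 window profile — and no witness of K1 — has its velocity, or its
# vorticity, at bounded distance from the precession axis on a backward parabolic cylinder at the
# space–time origin (two-velocity-components / two-vorticity-components criteria read on the ladder)

Refuter seat (ns-blowup-refuter g18), kernel census for crux K2 `NoOverheating`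
(stmt-NavierStokesRegularity-19960) of route `AngularGalerkinLadder`, Negative lane (`--supports`).
No definition, no named fact, no item verdict moves; nothing is asserted about Navier–Stokes.

Two families of printed regularity criteria ask for control of only PART of the velocity or of the
vorticity: regularity follows if TWO velocity components are in the Prodi–Serrin class (Bae–Choe,
whole space; Bae–Wolf, local Serrin-type version) — a fortiori if one is (Neustupa–Penel,
Kukavica–Ziane, Chemin–Zhang; Kukavica–Rusin–Ziane's local `ε`-regularity version on `Q_r`) — or if
TWO vorticity components are in the class `L^{q}_t L^{p}_x`, `2/q + 3/p = 2` (Chae–Choe 1999).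
On the profile class of the ladder these have an exact KINEMATIC shadow.  Under the rotated discrete
self-similarity `c Rᵀu(c²t, cRx) = u(t, x)` one has `u(s, x) = R(c⁻¹ u(s/c², c⁻¹R⁻¹x))`
(`slice_eq_conj_of_isRotatedDSS`, KJ-46) and `ω(s, x) = (det R) c⁻² R ω(s/c², c⁻¹R⁻¹x)`
(`curl_slice_eq_of_isRotatedDSS`).  If the line `ℝe` is `R`-invariant — `R e = e ∨ R e = −e`; for
`e ≠ 0` this says that `e` spans the rotation axis of `R` (or of `−R`), and by Euler's rotation
theorem EVERY `R ∈ O(3)` has such an `e ≠ 0` — then the DISTANCE of `u` (resp. `ω`) to the line `ℝe`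
scales by `c⁻¹` (resp. `c⁻²`) across one period.  Hence a bound `dist(u(t,x), ℝe) ≤ M` on one
backward parabolic cylinder `Q_ρ(0,0) = (−ρ², 0) × B_ρ(0)` propagates to `M/cᵏ` on `Q_{cᵏρ}(0,0)`;
every `(t, x)` with `t < 0` lies in these for all large `k`, so `u(t, x) ∈ ℝe` for ALL `t < 0`, `x`
(`exists_eq_smul_of_dist_axis_le_parabolicCylinder`, route-free module `TransversalAxisKinematics`) —
the velocity is everywhere parallel to ONE line.  A `C²` divergence-free slice `u(t) = a(·) e`, `e ≠ 0`, has `∂ₑa = div u(t) = 0`, so it is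
invariant under the translation by `e`, and Type-I spatial decay kills it (KJ-47
`rungProfile_slice_eq_zero_of_screw_invariant`).  The same propagation for `ω` gives `ω(t, x) ∈ ℝe`
everywhere, and a rung-profile slice with line-parallel vorticity is zero (KJ-49
`rungProfile_slice_eq_zero_of_parallelVorticity`).  Whence:

* `no_windowProfile_transversalVelocityBounded` — (S15) a single window profile (`0 < δ`) whose
  velocity stays at bounded distance from an `R`-invariant line `ℝe` on some `Q_ρ(0,0)` — in
  coordinates with `e = e₃`: the two velocity components `u₁, u₂` bounded near the space–time origin,
  `u₃` free — is contradictory; with `e = 0` this is Chae–Wolf's bounded-velocity exclusion (S11a);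
* `no_windowProfile_transversalVorticityBounded` — (S16) the same for the vorticity: `ω₁, ω₂` bounded
  on some `Q_ρ(0,0)`, `ω₃` free, is contradictory; with `e = 0` this is (S14);
* `not_nontrivial_rungProfile_of_transversalVelocityBounded` /
  `not_nontrivial_rungProfile_of_transversalVorticityBounded` — the same for K1's witnesses
  (`RungIsSingular L`): a nontrivial rung profile has BOTH transversal velocity and transversal
  vorticity (relative to the axis of its own `R`) unbounded on every `Q_ρ(0,0)`;
* `not_cofinal_and_noOverheating_transversalVelocityBounded` /
  `not_cofinal_and_noOverheating_transversalVorticityBounded` — the K1 ∧ K2 supply readings.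

Not covered (booked, not claimed): the ONE-component shadow — the axial component `⟪u, e⟫` bounded on
`Q_ρ(0,0)` — self-improves in the same way to `⟪u, e⟫ ≡ 0` (an axial-free rung flow), for which no
kinematic exclusion is known; it is not asserted here.

References: [cite: BaeChoe2007CPDE, main theorem (two velocity components in the Prodi–Serrin class; quoted in Beirão da Veiga 2017, arXiv:1612.07051 p. 2, refs. baechoe / baewolf)];
[cite: KukavicaRusinZiane2016, Thm. 2.1 (arXiv:1511.02807 p. 4)]; [cite: CheminZhang2016, Thm. 1.1];
[cite: ChaeChoe1999, Thm. 1 and Remark 1 (p. 2)]; [cite: ChaeWolf2017, §3, Step 1];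
[cite: GigaMiura2011, Prop. 2.2, proof (§2.1)]; [cite: KochNadirashviliSereginSverak2009, (1.6)].
-/

noncomputable section

namespace Summit.NavierStokesRegularity.AngularGalerkinLadderTransversalComponentsExcluded

open Set Function Filter Topology Metric
open Literature.Analysis Literature.Analysis.FluidPDE
open Summit.NavierStokesRegularity.FluidComputer
open Summit.NavierStokesRegularity.FluidComputer.AngularLadder
open Summit.NavierStokesRegularity.NavierStokesRegularity.Theses.AngularGalerkinLadder
open Summit.NavierStokesRegularity.AngularGalerkinLadderTranslationalSymmetryExcluded
open Summit.NavierStokesRegularity.AngularGalerkinLadderSineFormAlignmentExcluded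
open Summit.NavierStokesRegularity.AngularGalerkinLadderTransversalAxisKinematics
open scoped RealInnerProductSpace

/-! ### §1 Rung profiles, window profiles, K1's witnesses -/

variable {L : ℕ} {C₀ cmin cmax δ ε c : ℝ}
  {R : EuclideanSpace ℝ (Fin 3) ≃ₗᵢ[ℝ] EuclideanSpace ℝ (Fin 3)}
  {u : ℝ → EuclideanSpace ℝ (Fin 3) → EuclideanSpace ℝ (Fin 3)}
  {p : ℝ → EuclideanSpace ℝ (Fin 3) → ℝ}
  {d : ℝ → EuclideanSpace ℝ (Fin 3) → EuclideanSpace ℝ (Fin 3)}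
  {e : EuclideanSpace ℝ (Fin 3)}

/-- **A rung-profile slice everywhere parallel to one line is `≡ 0`**: if `e = 0` the slice is
zero outright; if `e ≠ 0` it is `C²`, divergence free and unidirectional, hence invariant under the
translation by `e` (`eq_of_parallel_of_isDivFree`), and Type-I spatial decay kills a translation-invariant slice (KJ-47).
[cite: KochNadirashviliSereginSverak2009, (1.6)] -/
theorem rungProfile_slice_eq_zero_of_parallel (hP : IsRungProfile L C₀ c R u p d) {t : ℝ}
    (ht : t < 0) (hpar : ∀ x, ∃ a : ℝ, u t x = a • e) : ∀ x, u t x = 0 := by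
  by_cases he : e = 0
  · intro x
    obtain ⟨a, ha⟩ := hpar x
    rw [ha, he, smul_zero]
  have hC2 : ContDiff ℝ 2 (u t) :=
    (hP.classical.smooth_velocity.contDiff_slice (mem_Iio.2 ht)).of_le (by norm_cast)
  have hdiv : VectorCalculus.IsDivFree (u t) := hP.classical.divFree t (mem_Iio.2 ht)
  exact rungProfile_slice_eq_zero_of_screw_invariant hP (LinearIsometryEquiv.refl ℝ _) rfl he ht
    fun x => by
      have h1 := eq_of_parallel_of_isDivFree hC2 hdiv he hpar x 1
      rw [one_smul] at h1
      simpa using congrArg (fun v => ‖v‖) h1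

/-- **A rung profile whose velocity stays at bounded distance from an `R`-invariant line on some
`Q_ρ(0,0)` vanishes at every negative time.**
[cite: BaeChoe2007CPDE, main theorem (two velocity components; quoted in Beirão da Veiga 2017, arXiv:1612.07051 p. 2)] -/
theorem rungProfile_eq_zero_of_transversalVelocityBounded (hP : IsRungProfile L C₀ c R u p d)
    (hRe : R e = e ∨ R e = -e) {ρ M : ℝ} (hρ : 0 < ρ)
    (hM : ∀ z ∈ parabolicCylinder ρ (0 : ℝ × EuclideanSpace ℝ (Fin 3)),
      ∃ a : ℝ, ‖u z.1 z.2 - a • e‖ ≤ M) :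
    ∀ t < 0, ∀ x, u t x = 0 := fun t ht =>
  rungProfile_slice_eq_zero_of_parallel hP ht
    (exists_eq_smul_of_dist_axis_le_parabolicCylinder hP.isRotatedDSS hP.one_lt hRe hρ hM t ht)

/-- **A rung profile whose vorticity stays at bounded distance from an `R`-invariant line on some
`Q_ρ(0,0)` vanishes at every negative time** (line-parallel slice vorticity, KJ-49).
[cite: ChaeChoe1999, Thm. 1 and Remark 1 (p. 2)] -/
theorem rungProfile_eq_zero_of_transversalVorticityBounded (hP : IsRungProfile L C₀ c R u p d)
    (hRe : R e = e ∨ R e = -e) {ρ M : ℝ} (hρ : 0 < ρ)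
    (hM : ∀ z ∈ parabolicCylinder ρ (0 : ℝ × EuclideanSpace ℝ (Fin 3)),
      ∃ a : ℝ, ‖curl (u z.1) z.2 - a • e‖ ≤ M) :
    ∀ t < 0, ∀ x, u t x = 0 := fun t ht =>
  rungProfile_slice_eq_zero_of_parallelVorticity hP ht
    (exists_curl_eq_smul_of_dist_axis_le_parabolicCylinder hP.isRotatedDSS hP.one_lt hRe hρ hM t ht)

/-- **(S15) for K1's witnesses**: a NONTRIVIAL rung profile (a witness of `RungIsSingular L`) has its
velocity at UNBOUNDED distance from every `R`-invariant line on every backward parabolic cylinder at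
the space–time origin — the two transversal velocity components blow up there.
[cite: BaeChoe2007CPDE, main theorem (two velocity components; quoted in Beirão da Veiga 2017, arXiv:1612.07051 p. 2)] -/
theorem not_nontrivial_rungProfile_of_transversalVelocityBounded
    (hP : IsRungProfile L C₀ c R u p d) (hRe : R e = e ∨ R e = -e) {ρ M : ℝ} (hρ : 0 < ρ)
    (hM : ∀ z ∈ parabolicCylinder ρ (0 : ℝ × EuclideanSpace ℝ (Fin 3)),
      ∃ a : ℝ, ‖u z.1 z.2 - a • e‖ ≤ M) :
    ¬ ∃ t < 0, ∃ x, u t x ≠ 0 := by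
  rintro ⟨t, ht, x, hx⟩
  exact hx (rungProfile_eq_zero_of_transversalVelocityBounded hP hRe hρ hM t ht x)

/-- **(S16) for K1's witnesses**: a NONTRIVIAL rung profile has its vorticity at UNBOUNDED distance
from every `R`-invariant line on every `Q_ρ(0,0)` — the two transversal vorticity components blow up
there. [cite: ChaeChoe1999, Thm. 1 and Remark 1 (p. 2)] -/
theorem not_nontrivial_rungProfile_of_transversalVorticityBounded
    (hP : IsRungProfile L C₀ c R u p d) (hRe : R e = e ∨ R e = -e) {ρ M : ℝ} (hρ : 0 < ρ)
    (hM : ∀ z ∈ parabolicCylinder ρ (0 : ℝ × EuclideanSpace ℝ (Fin 3)),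
      ∃ a : ℝ, ‖curl (u z.1) z.2 - a • e‖ ≤ M) :
    ¬ ∃ t < 0, ∃ x, u t x ≠ 0 := by
  rintro ⟨t, ht, x, hx⟩
  exact hx (rungProfile_eq_zero_of_transversalVorticityBounded hP hRe hρ hM t ht x)

/-- **(S15) NO WINDOW PROFILE HAS TRANSVERSAL VELOCITY BOUNDED NEAR THE SPACE–TIME ORIGIN**: a single
window profile with `0 < δ` whose velocity stays at bounded distance from an `R`-invariant line
`ℝe` on some `Q_ρ(0,0)` contradicts the amplitude floor `‖u(−1, x₀)‖ ≥ δ`.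
[cite: BaeChoe2007CPDE, main theorem (two velocity components; quoted in Beirão da Veiga 2017, arXiv:1612.07051 p. 2)] -/
theorem no_windowProfile_transversalVelocityBounded (hδ : 0 < δ)
    (hW : IsWindowProfile L C₀ cmin cmax δ ε c R u p d) (hRe : R e = e ∨ R e = -e) {ρ M : ℝ}
    (hρ : 0 < ρ)
    (hM : ∀ z ∈ parabolicCylinder ρ (0 : ℝ × EuclideanSpace ℝ (Fin 3)),
      ∃ a : ℝ, ‖u z.1 z.2 - a • e‖ ≤ M) :
    False := by
  obtain ⟨hP, -, -, ⟨x₀, hx₀⟩, -⟩ := hW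
  rw [rungProfile_eq_zero_of_transversalVelocityBounded hP hRe hρ hM (-1) (by norm_num) x₀,
    norm_zero] at hx₀
  exact absurd hx₀ (not_le.2 hδ)

/-- The strip form of (S15): transversal velocity bounded on a window strip `(−ρ², 0) × ℝ³` is
excluded. [cite: BaeChoe2007CPDE, main theorem (two velocity components; quoted in Beirão da Veiga 2017, arXiv:1612.07051 p. 2)] -/
theorem no_windowProfile_transversalVelocityBounded_strip (hδ : 0 < δ)
    (hW : IsWindowProfile L C₀ cmin cmax δ ε c R u p d) (hRe : R e = e ∨ R e = -e) {ρ M : ℝ}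
    (hρ : 0 < ρ) (hM : ∀ s ∈ Ioo (-ρ ^ 2) 0, ∀ x, ∃ a : ℝ, ‖u s x - a • e‖ ≤ M) : False :=
  no_windowProfile_transversalVelocityBounded hδ hW hRe hρ fun z hz => by
    rw [mem_parabolicCylinder] at hz
    exact hM z.1 (by simpa using hz.1) z.2

/-- **(S16) NO WINDOW PROFILE HAS TRANSVERSAL VORTICITY BOUNDED NEAR THE SPACE–TIME ORIGIN**: a
single window profile with `0 < δ` whose vorticity stays at bounded distance from an `R`-invariant
line `ℝe` on some `Q_ρ(0,0)` is contradictory. [cite: ChaeChoe1999, Thm. 1 and Remark 1 (p. 2)] -/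
theorem no_windowProfile_transversalVorticityBounded (hδ : 0 < δ)
    (hW : IsWindowProfile L C₀ cmin cmax δ ε c R u p d) (hRe : R e = e ∨ R e = -e) {ρ M : ℝ}
    (hρ : 0 < ρ)
    (hM : ∀ z ∈ parabolicCylinder ρ (0 : ℝ × EuclideanSpace ℝ (Fin 3)),
      ∃ a : ℝ, ‖curl (u z.1) z.2 - a • e‖ ≤ M) :
    False := by
  obtain ⟨hP, -, -, ⟨x₀, hx₀⟩, -⟩ := hW
  rw [rungProfile_eq_zero_of_transversalVorticityBounded hP hRe hρ hM (-1) (by norm_num) x₀,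
    norm_zero] at hx₀
  exact absurd hx₀ (not_le.2 hδ)

/-- The strip form of (S16): transversal vorticity bounded on a window strip `(−ρ², 0) × ℝ³` is
excluded. [cite: ChaeChoe1999, Thm. 1 and Remark 1 (p. 2)] -/
theorem no_windowProfile_transversalVorticityBounded_strip (hδ : 0 < δ)
    (hW : IsWindowProfile L C₀ cmin cmax δ ε c R u p d) (hRe : R e = e ∨ R e = -e) {ρ M : ℝ}
    (hρ : 0 < ρ) (hM : ∀ s ∈ Ioo (-ρ ^ 2) 0, ∀ x, ∃ a : ℝ, ‖curl (u s) x - a • e‖ ≤ M) :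
    False :=
  no_windowProfile_transversalVorticityBounded hδ hW hRe hρ fun z hz => by
    rw [mem_parabolicCylinder] at hz
    exact hM z.1 (by simpa using hz.1) z.2

/-! ### §2 The K1 ∧ K2 readings -/

/-- **K1 ∧ (K2 supplied by window profiles with transversal velocity bounded near the origin along
an `R`-invariant line) is contradictory** — at the FIRST singular rung past `L₀`; line, radius and
bound may depend on the rung.
[cite: BaeChoe2007CPDE, main theorem (two velocity components; quoted in Beirão da Veiga 2017, arXiv:1612.07051 p. 2)] -/
theorem not_cofinal_and_noOverheating_transversalVelocityBounded (C₀ : ℝ) :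
    ¬ (RungBlowupCofinal ∧ ∃ (cmin cmax δ : ℝ) (L₀ : ℕ) (ε : ℕ → ℝ), 1 < cmin ∧ 0 < δ ∧
        Tendsto ε atTop (𝓝 0) ∧ ∀ L ≥ L₀, RungIsSingular L →
          ∃ (c : ℝ) (R : EuclideanSpace ℝ (Fin 3) ≃ₗᵢ[ℝ] EuclideanSpace ℝ (Fin 3))
            (u : ℝ → EuclideanSpace ℝ (Fin 3) → EuclideanSpace ℝ (Fin 3))
            (p : ℝ → EuclideanSpace ℝ (Fin 3) → ℝ)
            (d : ℝ → EuclideanSpace ℝ (Fin 3) → EuclideanSpace ℝ (Fin 3)),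
            IsWindowProfile L C₀ cmin cmax δ (ε L) c R u p d ∧
              ∃ (e : EuclideanSpace ℝ (Fin 3)) (ρ M : ℝ), (R e = e ∨ R e = -e) ∧ 0 < ρ ∧
                ∀ z ∈ parabolicCylinder ρ (0 : ℝ × EuclideanSpace ℝ (Fin 3)),
                  ∃ a : ℝ, ‖u z.1 z.2 - a • e‖ ≤ M) := by
  rintro ⟨hK1, cmin, cmax, δ, L₀, ε, -, hδ, -, hsup⟩
  obtain ⟨L, hL, hsing⟩ := hK1 L₀
  obtain ⟨c, R, u, p, d, hW, e, ρ, M, hRe, hρ, hM⟩ := hsup L hL hsing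
  exact no_windowProfile_transversalVelocityBounded hδ hW hRe hρ hM

/-- **K1 ∧ (K2 supplied by window profiles with transversal vorticity bounded near the origin along
an `R`-invariant line) is contradictory.** [cite: ChaeChoe1999, Thm. 1 and Remark 1 (p. 2)] -/
theorem not_cofinal_and_noOverheating_transversalVorticityBounded (C₀ : ℝ) :
    ¬ (RungBlowupCofinal ∧ ∃ (cmin cmax δ : ℝ) (L₀ : ℕ) (ε : ℕ → ℝ), 1 < cmin ∧ 0 < δ ∧
        Tendsto ε atTop (𝓝 0) ∧ ∀ L ≥ L₀, RungIsSingular L →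
          ∃ (c : ℝ) (R : EuclideanSpace ℝ (Fin 3) ≃ₗᵢ[ℝ] EuclideanSpace ℝ (Fin 3))
            (u : ℝ → EuclideanSpace ℝ (Fin 3) → EuclideanSpace ℝ (Fin 3))
            (p : ℝ → EuclideanSpace ℝ (Fin 3) → ℝ)
            (d : ℝ → EuclideanSpace ℝ (Fin 3) → EuclideanSpace ℝ (Fin 3)),
            IsWindowProfile L C₀ cmin cmax δ (ε L) c R u p d ∧
              ∃ (e : EuclideanSpace ℝ (Fin 3)) (ρ M : ℝ), (R e = e ∨ R e = -e) ∧ 0 < ρ ∧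
                ∀ z ∈ parabolicCylinder ρ (0 : ℝ × EuclideanSpace ℝ (Fin 3)),
                  ∃ a : ℝ, ‖curl (u z.1) z.2 - a • e‖ ≤ M) := by
  rintro ⟨hK1, cmin, cmax, δ, L₀, ε, -, hδ, -, hsup⟩
  obtain ⟨L, hL, hsing⟩ := hK1 L₀
  obtain ⟨c, R, u, p, d, hW, e, ρ, M, hRe, hρ, hM⟩ := hsup L hL hsing
  exact no_windowProfile_transversalVorticityBounded hδ hW hRe hρ hM

end Summit.NavierStokesRegularity.AngularGalerkinLadderTransversalComponentsExcluded

end
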